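import Mathlib

/-!
# `BalabanUV.Beta.FP.AdInvariantColourVectors` — **NO Ad_{SU(N)}-INVARIANT VECTOR ∕ COVECTOR IN su(N), GROUP FORM** (β sub-cell,
# road «FP», sub-row GAMMA-0c (S4-AD) item (i), GROUP half «(i-G)»: the colour letter behind the tadpole hypothesis `htad` of GAMMA-0)

HONEST FRAMING (cell charter, verbatim): «discharging BetaPertH makes Balaban's UV stability UNCONDITIONAL — a real
constructive-QFT result; it is NOT the continuum limit and NOT the Clay problem.»  Neutral finite linear algebra ([folklore]; no
statement of Bałaban's papers, no `[cite:]`, no `Prop` fact, no `def`; imports `Mathlib` only); it instantiates 0∕4 row-D1 binders.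
NOT D1, NOT `BetaPertH`, NOT continuum, NOT Clay.  HONEST DEPENDENCY: continuum YM on T⁴ ⇐ BetaPertH ∧ nine spine estimates
(0/9 proved); BetaPertH ⇐ (D1) ∧ (D4) ∧ CAP+tail; G-an2-4 gates asym, D1 and NE2/3/4.

WHAT.  Road-FP owner's sub-row GAMMA-0c (CLAIMS.log 2026-08-21T01:16:45Z (E)): the displayed tadpole hypothesis `htad` of
`FP/OneShotKKTTorus` (GAMMA-0 (a)) is discharged on the road by GLOBAL COLOUR (Ad) INVARIANCE + SEMISIMPLICITY; its item (i) is the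
colour letter «`∀ c ∈ su(N)`, `N ≥ 2`, `(∀ g ∈ SU(N), g c g⁻¹ = c) → c = 0`».  THIS module proves that letter AT GROUP LEVEL — the
symmetry the road actually has (constant gauge transformations `g ∈ SU(N)` acting by `X ↦ g X gᴴ` on Bałaban's 𝔤 = Hermitian
traceless `N × N` matrices, `Beta.ColourTrace` convention (C1)) — in Mathlib's currency `Matrix.specialUnitaryGroup (Fin N) ℂ` BY NAME,
together with its dual «no invariant covector», which is the letter `hno` of the functional half GAMMA-0c (ii)+(iii)
(`FP/TadpoleAdInvariance`, beta-d1-formalise-leaf-05) for `ρ g := Ad_g`.  The INFINITESIMAL ∕ structure-constant form (centre of a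
complete colour table, `adMatC`) is the sibling module `FP/TadpoleAdInvarianceColour` (t4-ne7b-formalise-leaf-09-g20); zero overlap.

* §1 Two explicit test families in `SU(N)`: single-phase diagonals `diag(1,…,u,…,1)` (unitary for `u ū = 1`, determinant `u`); the
  PHASE PAIR `D_{ik} = diag(I at i)·diag(−I at k)` (det `I·(−I) = 1`), which NEGATES the `(i,k)`∕`(k,i)` entries and the Hermitian unit
  `z•E_ik + z̄•E_ki` under conjugation (`i ≠ k`); the SIGNED SWAP `R_{ab} = diag(−1 at a)·swap a b` (`a ≠ b`, det `(−1)·(−1) = 1`), with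
  `(R X Rᴴ)_{pq} = e_p e_q X_{σp,σq}` (`σ = Equiv.swap a b`), in particular `(R X Rᴴ)_{bb} = X_{aa}` and `R (E_aa − E_bb) Rᴴ = E_bb − E_aa`.
* §2 VECTOR FORM (the owner's (i) verbatim): `(∀ U ∈ SU(N), U X Uᴴ = X) → X ∈ range (Matrix.scalar (Fin N))` for EVERY matrix `X` and
  every `N` (`mem_range_scalar_of_conj_invariant`), hence `X.trace = 0 → N ≠ 0 → X = 0` (`eq_zero_of_conj_invariant`).
* §3 COVECTOR FORM (the letter `hno` at `ρ = Ad`): an ℝ-linear `T : Matrix (Fin N) (Fin N) ℂ →ₗ[ℝ] ℝ` invariant under `Ad_{SU(N)}` ON THE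
  HERMITIAN TRACELESS MATRICES ONLY vanishes on every Hermitian traceless matrix (`covector_eq_zero_of_conj_invariant`; the proof splits
  `X` into its off-diagonal part — `2•O = Σ_{p,q}` Hermitian units, killed by the phase pairs — and its diagonal part — a sum of real
  diagonal differences against a base index, killed by the signed swaps); bare additive + ℝ-homogeneous `T`
  (`covector_eq_zero_of_conj_invariant'`) and invariance-on-all-matrices (`covector_eq_zero_of_conj_invariant_all`) as corollaries.
  The restriction of the CONCLUSION to 𝔤 is sharp: `Re ∘ Tr` is ℝ-linear, `Ad`-invariant on all of `Mat_N(ℂ)` and `≠ 0` — so `hno` (whose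
  conclusion is «`T = 0`») lives on 𝔤-COORDINATES `C → ℝ`, where the companion `FP/AdInvariantColourCoords` states it with no side condition.

NOT HERE: the functional∕tadpole level (ii)+(iii); the infinitesimal∕structure-constant form (leaf-09-g20's module); the road's
Ad-EQUIVARIANCE of its families `Hf, Qf` (hypothesis S4-AD itself); `U(1)` (no such letter; owner: reflection substitute); anything
of Bałaban's series.  Provenance: NE7b formalise swarm leaf-04 gen 20, cross-cell kernel duty for road FP (owner b2b-balaban-beta-d1-p3),
2026-08-21; no existing file touched.  Tags: `[folklore]` = elementary linear algebra proved here.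
-/

namespace Summit.QuantumFields.BalabanUV.Beta.FP.AdInvariantColourVectors

open Matrix Complex
open scoped ComplexConjugate

variable {N : ℕ}

/-! ## §1 Two test families in `SU(N)` -/

/-- [folklore] A single-phase diagonal `diag(1,…,u,…,1)` with `u·ū = 1` is unitary. -/
theorem diagonal_phase_mem_unitaryGroup (i : Fin N) {u : ℂ} (hu : u * star u = 1) :
    diagonal (fun p : Fin N => if p = i then u else 1) ∈ Matrix.unitaryGroup (Fin N) ℂ := by
  rw [Matrix.mem_unitaryGroup_iff, star_eq_conjTranspose, diagonal_conjTranspose, diagonal_mul_diagonal, ← diagonal_one]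
  congr 1
  funext p
  simp only [Pi.star_apply]
  split_ifs
  · exact hu
  · simp

/-- [folklore] Its determinant is the phase `u`. -/
theorem det_diagonal_phase (i : Fin N) (u : ℂ) :
    det (diagonal (fun p : Fin N => if p = i then u else 1)) = u := by
  rw [det_diagonal, Finset.prod_ite_eq']
  simp

/-- [folklore] Conjugation by a diagonal matrix, entrywise: `(D X Dᴴ)_{pq} = d_p · X_{pq} · star d_q`. -/
theorem diagonal_conj_apply (d : Fin N → ℂ) (X : Matrix (Fin N) (Fin N) ℂ) (p q : Fin N) :
    (diagonal d * X * star (diagonal d)) p q = d p * X p q * star (d q) := by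
  rw [star_eq_conjTranspose, diagonal_conjTranspose, mul_diagonal, diagonal_mul, Pi.star_apply]

/-- [folklore] THE PHASE PAIR `D_{ik} := diag(I at i) · diag(−I at k)` lies in `SU(N)` for `i ≠ k` (det `= I · (−I) = 1`). -/
theorem phasePair_mem_specialUnitaryGroup (i k : Fin N) :
    diagonal (fun p : Fin N => if p = i then I else 1) * diagonal (fun p : Fin N => if p = k then -I else 1) ∈
      Matrix.specialUnitaryGroup (Fin N) ℂ := by
  rw [Matrix.mem_specialUnitaryGroup_iff]
  refine ⟨Submonoid.mul_mem _ (diagonal_phase_mem_unitaryGroup i (by simp))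
    (diagonal_phase_mem_unitaryGroup k (by simp)), ?_⟩
  rw [det_mul, det_diagonal_phase, det_diagonal_phase]
  simp

/-- [folklore] The phase pair as ONE diagonal matrix: `D_{ik} = diagonal d` with `d_i = I`, `d_k = −I`, `d_p = 1` otherwise. -/
theorem phasePair_eq_diagonal (i k : Fin N) :
    diagonal (fun p : Fin N => if p = i then I else 1) * diagonal (fun p : Fin N => if p = k then -I else 1) =
      diagonal (fun p : Fin N => (if p = i then I else 1) * (if p = k then -I else 1)) :=
  diagonal_mul_diagonal _ _

/-- [folklore] Conjugation by the phase pair NEGATES the `(i,k)` entry (`i ≠ k`): `(D X Dᴴ)_{ik} = −X_{ik}`. -/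
theorem phasePair_conj_apply_ik {i k : Fin N} (hik : i ≠ k) (X : Matrix (Fin N) (Fin N) ℂ) :
    (diagonal (fun p : Fin N => if p = i then I else 1) * diagonal (fun p : Fin N => if p = k then -I else 1) * X *
      star (diagonal (fun p : Fin N => if p = i then I else 1) * diagonal (fun p : Fin N => if p = k then -I else 1))) i k =
      -X i k := by
  rw [phasePair_eq_diagonal, diagonal_conj_apply]
  simp only [if_true, if_neg (Ne.symm hik), if_neg hik, one_mul, mul_one, star_neg, Complex.star_def, Complex.conj_I,
    neg_neg]
  linear_combination (X i k) * I_mul_I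

/-- [folklore] … and the `(k,i)` entry: `(D X Dᴴ)_{ki} = −X_{ki}`. -/
theorem phasePair_conj_apply_ki {i k : Fin N} (hik : i ≠ k) (X : Matrix (Fin N) (Fin N) ℂ) :
    (diagonal (fun p : Fin N => if p = i then I else 1) * diagonal (fun p : Fin N => if p = k then -I else 1) * X *
      star (diagonal (fun p : Fin N => if p = i then I else 1) * diagonal (fun p : Fin N => if p = k then -I else 1))) k i =
      -X k i := by
  rw [phasePair_eq_diagonal, diagonal_conj_apply]
  simp only [if_true, if_neg (Ne.symm hik), if_neg hik, one_mul, mul_one, Complex.star_def, Complex.conj_I, mul_neg,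
    neg_mul]
  linear_combination (X k i) * I_mul_I

/-- [folklore] Conjugation by the phase pair negates the Hermitian off-diagonal unit `z•E_ik + z̄•E_ki` (`i ≠ k`). -/
theorem phasePair_conj_hermOff {i k : Fin N} (hik : i ≠ k) (z : ℂ) :
    diagonal (fun p : Fin N => if p = i then I else 1) * diagonal (fun p : Fin N => if p = k then -I else 1) *
        (single i k z + single k i (star z)) *
      star (diagonal (fun p : Fin N => if p = i then I else 1) * diagonal (fun p : Fin N => if p = k then -I else 1)) =
      -(single i k z + single k i (star z)) := by
  rw [phasePair_eq_diagonal]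
  ext p q
  rw [diagonal_conj_apply, Matrix.neg_apply, Matrix.add_apply]
  by_cases h1 : i = p ∧ k = q
  · obtain ⟨rfl, rfl⟩ := h1
    rw [single_apply_same, single_apply_of_ne _ _ _ _ _ (show ¬(k = i ∧ i = k) from fun h => hik h.2)]
    simp only [if_true, if_neg hik, if_neg (Ne.symm hik), one_mul, mul_one, add_zero, star_neg, Complex.star_def,
      Complex.conj_I, neg_neg]
    linear_combination z * I_mul_I
  · by_cases h2 : k = p ∧ i = q
    · obtain ⟨rfl, rfl⟩ := h2
      rw [single_apply_same, single_apply_of_ne _ _ _ _ _ (show ¬(i = k ∧ k = i) from fun h => hik h.1)]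
      simp only [if_true, if_neg hik, if_neg (Ne.symm hik), one_mul, mul_one, zero_add, Complex.star_def,
        Complex.conj_I, mul_neg, neg_mul, neg_neg]
      linear_combination (starRingEnd ℂ z) * I_mul_I
    · rw [single_apply_of_ne _ _ _ _ _ h1, single_apply_of_ne _ _ _ _ _ h2, add_zero, mul_zero, zero_mul, neg_zero]

/-- [folklore] The swap matrix is unitary. -/
theorem swap_mem_unitaryGroup (a b : Fin N) : Matrix.swap ℂ a b ∈ Matrix.unitaryGroup (Fin N) ℂ := by
  rw [Matrix.mem_unitaryGroup_iff, star_eq_conjTranspose, conjTranspose_swap, swap_mul_self]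

/-- [folklore] `det (swap a b) = −1` for `a ≠ b`. -/
theorem det_swap {a b : Fin N} (hab : a ≠ b) : det (Matrix.swap ℂ a b) = -1 := by
  rw [Matrix.swap, Matrix.det_permutation, Equiv.Perm.sign_swap hab]
  simp

/-- [folklore] THE SIGNED SWAP `R_{ab} := diag(−1 at a) · swap a b` lies in `SU(N)` for `a ≠ b` (det `= (−1)·(−1) = 1`). -/
theorem signedSwap_mem_specialUnitaryGroup {a b : Fin N} (hab : a ≠ b) :
    diagonal (fun p : Fin N => if p = a then (-1 : ℂ) else 1) * Matrix.swap ℂ a b ∈ Matrix.specialUnitaryGroup (Fin N) ℂ := by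
  rw [Matrix.mem_specialUnitaryGroup_iff]
  refine ⟨Submonoid.mul_mem _ (diagonal_phase_mem_unitaryGroup a (by simp)) (swap_mem_unitaryGroup a b), ?_⟩
  rw [det_mul, det_diagonal_phase, det_swap hab]
  norm_num

/-- [folklore] Entries of a two-sided swap: `(swap a b · X · swap a b)_{pq} = X_{σ p, σ q}`, `σ = Equiv.swap a b`. -/
theorem swap_mul_mul_swap_apply (a b : Fin N) (X : Matrix (Fin N) (Fin N) ℂ) (p q : Fin N) :
    (Matrix.swap ℂ a b * X * Matrix.swap ℂ a b) p q = X (Equiv.swap a b p) (Equiv.swap a b q) := by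
  rw [Matrix.swap, Equiv.Perm.permMatrix, PEquiv.mul_toMatrix_toPEquiv, PEquiv.toMatrix_toPEquiv_mul, Equiv.symm_swap]
  rfl

/-- [folklore] Conjugation by the signed swap, entrywise: `(R X Rᴴ)_{pq} = e_p · e_q · X_{σ p, σ q}` with `e = (−1 at a, 1 else)`. -/
theorem signedSwap_conj_apply (a b : Fin N) (X : Matrix (Fin N) (Fin N) ℂ) (p q : Fin N) :
    (diagonal (fun p : Fin N => if p = a then (-1 : ℂ) else 1) * Matrix.swap ℂ a b * X *
      star (diagonal (fun p : Fin N => if p = a then (-1 : ℂ) else 1) * Matrix.swap ℂ a b)) p q =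
      (if p = a then (-1 : ℂ) else 1) * (if q = a then (-1 : ℂ) else 1) * X (Equiv.swap a b p) (Equiv.swap a b q) := by
  have hstar : star (diagonal (fun p : Fin N => if p = a then (-1 : ℂ) else 1) * Matrix.swap ℂ a b) =
      Matrix.swap ℂ a b * diagonal (fun p : Fin N => if p = a then (-1 : ℂ) else 1) := by
    rw [star_mul, star_eq_conjTranspose, conjTranspose_swap, star_eq_conjTranspose, diagonal_conjTranspose]
    congr 2
    funext p
    simp only [Pi.star_apply]
    split_ifs <;> simp
  rw [hstar, show diagonal (fun p : Fin N => if p = a then (-1 : ℂ) else 1) * Matrix.swap ℂ a b * X *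
      (Matrix.swap ℂ a b * diagonal (fun p : Fin N => if p = a then (-1 : ℂ) else 1)) =
      diagonal (fun p : Fin N => if p = a then (-1 : ℂ) else 1) * (Matrix.swap ℂ a b * X * Matrix.swap ℂ a b) *
      diagonal (fun p : Fin N => if p = a then (-1 : ℂ) else 1) by simp only [Matrix.mul_assoc],
    mul_diagonal, diagonal_mul, swap_mul_mul_swap_apply]
  ring

/-- [folklore] The `(b,b)` entry after conjugation by the signed swap is `X_{aa}` (`a ≠ b`). -/
theorem signedSwap_conj_apply_bb {a b : Fin N} (hab : a ≠ b) (X : Matrix (Fin N) (Fin N) ℂ) :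
    (diagonal (fun p : Fin N => if p = a then (-1 : ℂ) else 1) * Matrix.swap ℂ a b * X *
      star (diagonal (fun p : Fin N => if p = a then (-1 : ℂ) else 1) * Matrix.swap ℂ a b)) b b = X a a := by
  rw [signedSwap_conj_apply]
  simp [Ne.symm hab, Equiv.swap_apply_right]

/-- [folklore] Conjugation by the signed swap flips the diagonal difference: `R (c•E_aa − c•E_bb) Rᴴ = c•E_bb − c•E_aa` (`a ≠ b`). -/
theorem signedSwap_conj_diagDiff {a b : Fin N} (hab : a ≠ b) (c : ℂ) :
    diagonal (fun p : Fin N => if p = a then (-1 : ℂ) else 1) * Matrix.swap ℂ a b * (single a a c - single b b c) *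
      star (diagonal (fun p : Fin N => if p = a then (-1 : ℂ) else 1) * Matrix.swap ℂ a b) =
      -(single a a c - single b b c) := by
  ext p q
  rw [signedSwap_conj_apply, Matrix.neg_apply, Matrix.sub_apply, Matrix.sub_apply]
  by_cases hpq : p = q
  · subst hpq
    have he : ((if p = a then (-1 : ℂ) else 1) * if p = a then (-1 : ℂ) else 1) = 1 := by split_ifs <;> norm_num
    rw [he, one_mul]
    rcases eq_or_ne p a with rfl | hpa
    · rw [Equiv.swap_apply_left, single_apply_of_ne _ _ _ _ _ (show ¬(p = b ∧ p = b) from fun h => hab h.1), single_apply_same,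
        single_apply_same, single_apply_of_ne _ _ _ _ _ (show ¬(b = p ∧ b = p) from fun h => hab h.1.symm)]
      ring
    · rcases eq_or_ne p b with rfl | hpb
      · rw [Equiv.swap_apply_right, single_apply_same, single_apply_of_ne _ _ _ _ _ (show ¬(p = a ∧ p = a) from fun h => hpa h.1),
          single_apply_of_ne _ _ _ _ _ (show ¬(a = p ∧ a = p) from fun h => hpa h.1.symm), single_apply_same]
        ring
      · rw [Equiv.swap_apply_of_ne_of_ne hpa hpb, single_apply_of_ne _ _ _ _ _ (show ¬(a = p ∧ a = p) from fun h => hpa h.1.symm),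
          single_apply_of_ne _ _ _ _ _ (show ¬(b = p ∧ b = p) from fun h => hpb h.1.symm)]
        ring
  · have hσ : Equiv.swap a b p ≠ Equiv.swap a b q := fun h => hpq ((Equiv.swap a b).injective h)
    rw [single_apply_of_ne _ _ _ _ _ (show ¬(a = Equiv.swap a b p ∧ a = Equiv.swap a b q) from fun h => hσ (h.1.symm.trans h.2)),
      single_apply_of_ne _ _ _ _ _ (show ¬(b = Equiv.swap a b p ∧ b = Equiv.swap a b q) from fun h => hσ (h.1.symm.trans h.2)),
      single_apply_of_ne _ _ _ _ _ (show ¬(a = p ∧ a = q) from fun h => hpq (h.1.symm.trans h.2)),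
      single_apply_of_ne _ _ _ _ _ (show ¬(b = p ∧ b = q) from fun h => hpq (h.1.symm.trans h.2))]
    ring

/-! ## §2 VECTOR FORM: no `Ad_{SU(N)}`-invariant vector in su(N) -/

/-- [folklore] **A matrix fixed by conjugation with every element of `SU(N)` is scalar** (any `X`, any `N`; the group — not the
algebra — acts: the phase pairs kill the off-diagonal entries, the signed swaps equalise the diagonal ones). -/
theorem mem_range_scalar_of_conj_invariant {X : Matrix (Fin N) (Fin N) ℂ}
    (hX : ∀ U : Matrix (Fin N) (Fin N) ℂ, U ∈ Matrix.specialUnitaryGroup (Fin N) ℂ → U * X * star U = X) :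
    X ∈ Set.range (Matrix.scalar (Fin N)) := by
  rcases isEmpty_or_nonempty (Fin N) with hN | ⟨⟨i₀⟩⟩
  · exact ⟨0, Subsingleton.elim _ _⟩
  refine ⟨X i₀ i₀, Matrix.ext fun p q => ?_⟩
  simp only [scalar_apply, diagonal_apply]
  by_cases hpq : p = q
  · subst hpq
    rw [if_pos rfl]
    by_cases hp : p = i₀
    · rw [hp]
    · have h := congrFun (congrFun (hX _ (signedSwap_mem_specialUnitaryGroup (Ne.symm hp))) p) p
      rw [signedSwap_conj_apply_bb (Ne.symm hp)] at h
      exact h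
  · rw [if_neg hpq]
    have h := congrFun (congrFun (hX _ (phasePair_mem_specialUnitaryGroup p q)) p) q
    rw [phasePair_conj_apply_ik hpq] at h
    have h2 : (2 : ℂ) * X p q = 0 := by linear_combination -h
    exact ((mul_eq_zero.mp h2).resolve_left two_ne_zero).symm

/-- [folklore] **su(N) HAS NO NON-ZERO `Ad_{SU(N)}`-INVARIANT VECTOR** (the owner's item (i) of GAMMA-0c verbatim, matrix currency):
a TRACELESS matrix fixed by conjugation with every `U ∈ SU(N)` is zero (`N ≠ 0`; for `N = 1` this is `trace X = 0 → X = 0`). -/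
theorem eq_zero_of_conj_invariant (hN : N ≠ 0) {X : Matrix (Fin N) (Fin N) ℂ}
    (hX : ∀ U : Matrix (Fin N) (Fin N) ℂ, U ∈ Matrix.specialUnitaryGroup (Fin N) ℂ → U * X * star U = X)
    (h0 : X.trace = 0) : X = 0 := by
  obtain ⟨c, hc⟩ := mem_range_scalar_of_conj_invariant hX
  rw [← hc, scalar_apply, trace_diagonal] at h0
  simp only [Finset.sum_const, Finset.card_univ, Fintype.card_fin, nsmul_eq_mul, mul_eq_zero, Nat.cast_eq_zero] at h0
  rcases h0 with h0 | h0
  · exact absurd h0 hN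
  · rw [← hc, h0]; simp

/-! ## §3 COVECTOR FORM: no `Ad_{SU(N)}`-invariant covector on su(N) (the letter `hno`) -/

/-- [folklore] An invariant ℝ-linear functional kills every Hermitian off-diagonal unit `z•E_ik + z̄•E_ki`, `i ≠ k`. -/
theorem covector_hermOff_eq_zero (T : Matrix (Fin N) (Fin N) ℂ →ₗ[ℝ] ℝ)
    (hT : ∀ U : Matrix (Fin N) (Fin N) ℂ, U ∈ Matrix.specialUnitaryGroup (Fin N) ℂ →
      ∀ X : Matrix (Fin N) (Fin N) ℂ, X.IsHermitian → X.trace = 0 → T (U * X * star U) = T X)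
    {i k : Fin N} (hik : i ≠ k) (z : ℂ) : T (single i k z + single k i (star z)) = 0 := by
  have hH : (single i k z + single k i (star z)).IsHermitian := by
    unfold Matrix.IsHermitian
    rw [conjTranspose_add, conjTranspose_single, conjTranspose_single, star_star, add_comm]
  have htr : (single i k z + single k i (star z)).trace = 0 := by
    rw [trace_add, trace_single_eq_of_ne _ _ _ hik, trace_single_eq_of_ne _ _ _ (Ne.symm hik), add_zero]
  have h := hT _ (phasePair_mem_specialUnitaryGroup i k) _ hH htr
  rw [phasePair_conj_hermOff hik, map_neg] at h
  linarith

/-- [folklore] … and every real diagonal difference `r•E_aa − r•E_bb`. -/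
theorem covector_diagDiff_eq_zero (T : Matrix (Fin N) (Fin N) ℂ →ₗ[ℝ] ℝ)
    (hT : ∀ U : Matrix (Fin N) (Fin N) ℂ, U ∈ Matrix.specialUnitaryGroup (Fin N) ℂ →
      ∀ X : Matrix (Fin N) (Fin N) ℂ, X.IsHermitian → X.trace = 0 → T (U * X * star U) = T X)
    (a b : Fin N) (r : ℝ) : T (single a a (r : ℂ) - single b b (r : ℂ)) = 0 := by
  by_cases hab : a = b
  · subst hab; simp
  have hH : (single a a (r : ℂ) - single b b (r : ℂ)).IsHermitian := by
    unfold Matrix.IsHermitian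
    rw [conjTranspose_sub, conjTranspose_single, conjTranspose_single, Complex.star_def, Complex.conj_ofReal]
  have htr : (single a a (r : ℂ) - single b b (r : ℂ)).trace = 0 := by
    rw [trace_sub, trace_single_eq_same, trace_single_eq_same, sub_self]
  have h := hT _ (signedSwap_mem_specialUnitaryGroup hab) _ hH htr
  rw [signedSwap_conj_diagDiff hab, map_neg] at h
  linarith

/-- [folklore] The symmetrised double sum of Hermitian off-diagonal units over the off-diagonal part `O` of a Hermitian `X`
(`O_pq = X_pq` for `p ≠ q`, `O_pp = 0`) is `2•O`. -/
theorem sum_hermOff_offDiag {X : Matrix (Fin N) (Fin N) ℂ} (hX : X.IsHermitian) :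
    ∑ p, ∑ q, (single p q (if p = q then 0 else X p q) + single q p (star (if p = q then 0 else X p q))) =
      (2 : ℝ) • (X - diagonal (fun p => X p p)) := by
  have hO : (Matrix.of fun p q : Fin N => if p = q then (0 : ℂ) else X p q) = X - diagonal (fun p => X p p) := by
    ext p q
    by_cases h : p = q
    · subst h; simp
    · simp [h]
  have hOH : (X - diagonal (fun p => X p p)).IsHermitian := by
    refine hX.sub (isHermitian_diagonal_of_self_adjoint _ ?_)
    rw [IsSelfAdjoint]
    funext p
    exact hX.apply p p
  have h1 := sum_sum_single (fun p q : Fin N => if p = q then (0 : ℂ) else X p q)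
  have h2 := sum_sum_single (fun q p : Fin N => star (if p = q then (0 : ℂ) else X p q))
  simp only [Finset.sum_add_distrib]
  rw [h1, Finset.sum_comm, h2]
  have h3 : (Matrix.of fun q p : Fin N => star (if p = q then (0 : ℂ) else X p q)) = (X - diagonal (fun p => X p p))ᴴ := by
    rw [← hO]; ext q p; simp only [conjTranspose_apply, of_apply]
  rw [hO, h3, hOH.eq, two_smul]

/-- [folklore] The diagonal part of a Hermitian TRACELESS matrix is a sum of real diagonal differences against a base index `i₀`:
`diag(X) = Σ_p (Re X_pp)•(E_pp − E_{i₀i₀})`. -/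
theorem diagonal_eq_sum_diagDiff {X : Matrix (Fin N) (Fin N) ℂ} (hX : X.IsHermitian) (h0 : X.trace = 0) (i₀ : Fin N) :
    diagonal (fun p => X p p) = ∑ p, (single p p ((X p p).re : ℂ) - single i₀ i₀ ((X p p).re : ℂ)) := by
  have hre : ∀ p, ((X p p).re : ℂ) = X p p := fun p => by
    have h := hX.apply p p
    rw [Complex.star_def] at h
    exact Complex.conj_eq_iff_re.mp h
  simp only [hre, Finset.sum_sub_distrib, sum_single_eq_diagonal]
  have hsum : ∑ p, single i₀ i₀ (X p p) = single i₀ i₀ (X.trace) := by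
    rw [Matrix.trace]
    induction (Finset.univ : Finset (Fin N)) using Finset.induction_on with
    | empty => simp
    | insert a s ha ih => rw [Finset.sum_insert ha, Finset.sum_insert ha, ih, single_add]; rfl
  rw [hsum, h0, single_zero, sub_zero]

/-- [folklore] **NO `Ad_{SU(N)}`-INVARIANT COVECTOR ON su(N)** — the letter `hno` of GAMMA-0c (ii) at the single-site colour space:
an ℝ-linear functional on the `N × N` complex matrices which is invariant under `X ↦ U X Uᴴ`, `U ∈ SU(N)`, ON THE HERMITIAN TRACELESS
MATRICES vanishes on every Hermitian traceless matrix (any `N`). -/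
theorem covector_eq_zero_of_conj_invariant (T : Matrix (Fin N) (Fin N) ℂ →ₗ[ℝ] ℝ)
    (hT : ∀ U : Matrix (Fin N) (Fin N) ℂ, U ∈ Matrix.specialUnitaryGroup (Fin N) ℂ →
      ∀ X : Matrix (Fin N) (Fin N) ℂ, X.IsHermitian → X.trace = 0 → T (U * X * star U) = T X)
    {X : Matrix (Fin N) (Fin N) ℂ} (hX : X.IsHermitian) (h0 : X.trace = 0) : T X = 0 := by
  rcases isEmpty_or_nonempty (Fin N) with hN | ⟨⟨i₀⟩⟩
  · rw [Subsingleton.elim X 0, map_zero]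
  -- off-diagonal part
  have hoff : T (X - diagonal (fun p => X p p)) = 0 := by
    have h2 : (2 : ℝ) * T (X - diagonal (fun p => X p p)) = 0 := by
      rw [← smul_eq_mul, ← map_smul, ← sum_hermOff_offDiag hX, map_sum]
      refine Finset.sum_eq_zero fun p _ => ?_
      rw [map_sum]
      refine Finset.sum_eq_zero fun q _ => ?_
      by_cases hpq : p = q
      · subst hpq; simp
      · simpa [hpq] using covector_hermOff_eq_zero T hT hpq (X p q)
    linarith
  -- diagonal part
  have hdiag : T (diagonal (fun p => X p p)) = 0 := by
    rw [diagonal_eq_sum_diagDiff hX h0 i₀, map_sum]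
    exact Finset.sum_eq_zero fun p _ => covector_diagDiff_eq_zero T hT p i₀ _
  have : X = (X - diagonal (fun p => X p p)) + diagonal (fun p => X p p) := by abel
  rw [this, map_add, hoff, hdiag, add_zero]

/-- [folklore] The same for a bare function `T` that is additive and ℝ-homogeneous (the literal shape of `hno`). -/
theorem covector_eq_zero_of_conj_invariant' (T : Matrix (Fin N) (Fin N) ℂ → ℝ)
    (hadd : ∀ X Y, T (X + Y) = T X + T Y) (hsmul : ∀ (r : ℝ) X, T (r • X) = r * T X)
    (hT : ∀ U : Matrix (Fin N) (Fin N) ℂ, U ∈ Matrix.specialUnitaryGroup (Fin N) ℂ →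
      ∀ X : Matrix (Fin N) (Fin N) ℂ, X.IsHermitian → X.trace = 0 → T (U * X * star U) = T X)
    {X : Matrix (Fin N) (Fin N) ℂ} (hX : X.IsHermitian) (h0 : X.trace = 0) : T X = 0 := by
  let L : Matrix (Fin N) (Fin N) ℂ →ₗ[ℝ] ℝ :=
    { toFun := T, map_add' := hadd, map_smul' := fun r X => by rw [hsmul, RingHom.id_apply, smul_eq_mul] }
  exact covector_eq_zero_of_conj_invariant L hT hX h0

/-- [folklore] Cruder corollary: invariance on ALL matrices ⟹ `T` vanishes on the Hermitian traceless ones. -/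
theorem covector_eq_zero_of_conj_invariant_all (T : Matrix (Fin N) (Fin N) ℂ →ₗ[ℝ] ℝ)
    (hT : ∀ U : Matrix (Fin N) (Fin N) ℂ, U ∈ Matrix.specialUnitaryGroup (Fin N) ℂ →
      ∀ X : Matrix (Fin N) (Fin N) ℂ, T (U * X * star U) = T X)
    {X : Matrix (Fin N) (Fin N) ℂ} (hX : X.IsHermitian) (h0 : X.trace = 0) : T X = 0 :=
  covector_eq_zero_of_conj_invariant T (fun U hU X _ _ => hT U hU X) hX h0

end Summit.QuantumFields.BalabanUV.Beta.FP.AdInvariantColourVectors
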